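import Literature.Barriers.RiemannHypothesis.TuranPartialSumsCheckInv
import HarnessLib

/-!
# Sections of `ζ` beyond `σ = 1`: soundness of the certificate checker, IV (the main loop)

Barrier catalogue `Literature/Barriers/RiemannHypothesis/`, continuation of
`TuranPartialSumsCheckInv.lean`. Pure proof file (nothing is defined or asserted): the main step
`mainStep` of `TuranPartialSumsCheck.lean` preserves the invariant `Inv` (`mainStep_inv`: the four
branches — smooth `j` with or without a snapshot, a free prime `j = r` with the verified square root
and the two possible updates of the maximal ratio `hn/hd`, a composite non-smooth `j`), and so does
the run `mainGo` (`mainGo_inv`).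

## References

* [PlattTrudgian2016] D. J. Platt, T. S. Trudgian, LMS J. Comput. Math. 19 (2016), §2.
-/

noncomputable section

namespace Literature.Barriers.RiemannHypothesis.TuranCheck

open Literature.Barriers.RiemannHypothesis Complex Finset

section Step

variable {N W K M : ℕ} {es : List (ℕ × ℤ × ℤ × ℕ)} (hv : Valid es)
  (hSall : ∀ p : ℕ, p.Prime → p * p ≤ N → p ∈ keySet es)
  (hK : K * K ≤ N) (hK' : N < (K + 1) * (K + 1))
include hv hSall hK hK'

/-- **The main step preserves the invariant.** [folklore] -/
theorem mainStep_inv {n : ℕ} (hnN : n + 1 ≤ N) {Bre Bim : ℤ} {Lrev : List (ℤ × ℤ)}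
    {Rsum hn hd : ℕ} (hinv : Inv N W K M es n Bre Bim Lrev Rsum hn hd)
    {st : ℤ × ℤ × List (ℤ × ℤ) × ℕ × ℕ × ℕ}
    (hstep : mainStep N W K M es (n + 1) Bre Bim Lrev Rsum hn hd = some st) :
    Inv N W K M es (n + 1) st.1 st.2.1 st.2.2.1 st.2.2.2.1 st.2.2.2.2.1 st.2.2.2.2.2 := by
  obtain ⟨iB, ilen, iL, iR, ihd, iH⟩ := hinv
  set T := freePrimes N (keySet es) with hT
  set ω := phaseOf es with hω
  -- the stripping data of `j = n + 1`
  rcases hs : stripAll es (n + 1) with ⟨m, gr, gi, D⟩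
  rw [mainStep, hs] at hstep
  simp only [nat_mul_eq, nat_mod_eq', nat_div_eq', nat_sub_eq, nat_add_eq, int_add_eq,
    int_mul_eq, Int.ofNat_eq_natCast] at hstep
  cases hm0 : Nat.beq m 0
  case true => rw [hm0] at hstep; exact absurd hstep (by simp)
  rw [hm0, cond_false] at hstep
  rw [beq_false_iff] at hm0
  have hs' : stripGo 128 es (n + 1) 1 0 1 = (m, gr, gi, D) := hs
  have hne : (stripAll es (n + 1)).1 ≠ 0 := by rw [hs]; exact hm0
  have hsm_iff := smooth_iff_of_strip hv (m := n + 1) (by omega) hne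
  have hself_iff := eq_self_iff_of_strip hv (m := n + 1) (by omega) hne
  rw [hs] at hsm_iff hself_iff
  simp only at hsm_iff hself_iff
  obtain ⟨hkey, -, hphase, hden⟩ := stripGo_spec 128 es (n + 1) 1 0 1 hv (by omega)
    (by rw [hs']; exact hm0)
  rw [hs'] at hkey hphase hden
  simp only [Int.cast_one, Int.cast_zero, zero_mul, add_zero, one_mul] at hkey hphase hden
  -- free primes `≤ n + 1` when `n + 1 ∉ T`
  have hTfilt : n + 1 ∉ T → T.filter (· ≤ n + 1) = T.filter (· ≤ n) := fun h ↦ by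
    rw [filter_le_succ, if_neg h]
  have hHmono : n + 1 ∉ T → ∀ r ∈ T, r ≤ n + 1 → r ≤ n := fun h r hr hle ↦ by
    rcases Nat.lt_or_ge r (n + 1) with hlt | hge
    · omega
    · exact absurd (show r = n + 1 by omega ▸ hr) h
  cases hm1 : Nat.beq m 1
  case false =>
    ----------------------------------------------------------------- not smooth
    rw [hm1, cond_false] at hstep
    rw [beq_false_iff] at hm1
    have hns : ¬ (n + 1).primeFactors ⊆ keySet es := fun h ↦ hm1 (hsm_iff.2 h)
    have hBfilt : (Finset.Icc 1 (n + 1)).filter (fun j ↦ j.primeFactors ⊆ keySet es) =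
        (Finset.Icc 1 n).filter (fun j ↦ j.primeFactors ⊆ keySet es) := by
      rw [filter_Icc_succ, if_neg hns]
    cases hjK : Nat.ble (n + 1) K
    case true => rw [hjK] at hstep; exact absurd hstep (by simp)
    rw [hjK, cond_false] at hstep
    rw [ble_false_iff, not_le] at hjK
    have hminS : min (n + 1) K = K := min_eq_right hjK.le
    have hmin : min n K = K := min_eq_right (by omega)
    cases hmj : Nat.beq m (n + 1)
    case false =>
      --------------------------------------------------------------- composite: nothing changes
      rw [hmj, cond_false] at hstep
      rw [beq_false_iff] at hmj
      obtain rfl := Option.some.inj hstep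
      have hnT : n + 1 ∉ T := fun h ↦
        hmj (hself_iff.2 ((noKeyDvd_iff_mem_freePrimes hv hSall hK hK' hjK hnN).2 h))
      exact
        { hB := by rw [hBfilt]; exact iB
          hlen := by rw [hminS, ← hmin]; exact ilen
          hL := by rw [hminS, ← hmin]; exact iL
          hR := by rw [hTfilt hnT]; exact iR
          hhd := ihd
          hH := fun r hr hle ↦ iH r hr (hHmono hnT r hr hle) }
    case true =>
      --------------------------------------------------------------- a free prime `r = n + 1`
      rw [hmj, cond_true] at hstep
      rw [beq_true_iff] at hmj
      have hrT : n + 1 ∈ T :=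
        (noKeyDvd_iff_mem_freePrimes hv hSall hK hK' hjK hnN).1 (hself_iff.1 hmj)
      obtain ⟨-, hk1, hkK⟩ := freePrime_bounds hv hSall hK hK' hrT
      set k := N / (n + 1) with hk
      -- the snapshot `L_k`
      rcases hget : Lrev.getD (K - k) ((0 : ℤ), (0 : ℤ)) with ⟨lr, li⟩
      rw [hget] at hstep
      simp only at hstep
      have hidx : K - k < min n K := by rw [hmin]; omega
      have hLk : (lr : ℂ) + (li : ℂ) * I = (M : ℂ) * prefSum ω k := by
        have := iL (K - k) hidx
        rw [hget, hmin, Nat.sub_sub_self hkK] at this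
        exact this
      -- the verified square root
      set q := normSq lr li with hq
      set s := isqrt q with hsdef
      cases hchk : (Nat.ble (s * s) q && Nat.blt q ((s + 1) * (s + 1)))
      case false => rw [hchk] at hstep; exact absurd hstep (by simp)
      rw [hchk, cond_true] at hstep
      rw [Bool.and_eq_true, ble_true_iff, blt_true_iff] at hchk
      set ρ' : ℝ := ‖(lr : ℂ) + (li : ℂ) * I‖ with hρ'
      have hρ'q : ρ' ^ 2 = q := norm_sq_eq_normSq lr li
      obtain ⟨hsρ, hρs⟩ := sqrt_bounds (norm_nonneg _) hρ'q hchk.1 hchk.2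
      -- `ρ' = M (n+1) ρ_{n+1}`
      have hn1 : (0 : ℝ) < (n : ℝ) + 1 := by positivity
      have hcoef : (M : ℝ) * ‖bigCoeff N ω (n + 1) 1‖ = ρ' / (n + 1 : ℕ) := by
        rw [bigCoeff_one_eq N ω (by omega : n + 1 ≠ 0), ← hk, norm_mul, norm_inv,
          Complex.norm_natCast, hρ', hLk, norm_mul, Complex.norm_natCast]
        field_simp
      have hρle : (M : ℝ) * ‖bigCoeff N ω (n + 1) 1‖ < ((s + 1 : ℕ) : ℝ) / ((n + 1 : ℕ) : ℝ) := by
        rw [hcoef]; push_cast; exact div_lt_div_of_pos_right hρs hn1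
      -- `Rsum'`
      have hRsum : ((Rsum + W * s / (n + 1) : ℕ) : ℝ) ≤
          W * M * ∑ r ∈ T.filter (· ≤ n + 1), ‖bigCoeff N ω r 1‖ := by
        have hnotin : n + 1 ∉ T.filter (· ≤ n) := by simp
        rw [filter_le_succ, if_pos hrT, Finset.sum_insert hnotin, mul_add]
        have hdiv : ((W * s / (n + 1) : ℕ) : ℝ) ≤ (W : ℝ) * s / (n + 1 : ℕ) := by
          have := Nat.cast_div_le (m := W * s) (n := n + 1) (α := ℝ)
          push_cast at this ⊢
          exact this
        have hterm : (W : ℝ) * s / (n + 1 : ℕ) ≤ W * M * ‖bigCoeff N ω (n + 1) 1‖ := by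
          rw [mul_assoc, hcoef, mul_div_assoc]
          exact mul_le_mul_of_nonneg_left (div_le_div_of_nonneg_right hsρ (by positivity))
            (by positivity)
        push_cast
        linarith
      -- the two possible new states
      cases hup : Nat.blt (hn * (n + 1)) ((s + 1) * hd)
      case false =>
        rw [hup, cond_false] at hstep
        rw [blt_false_iff, not_lt] at hup
        obtain rfl := Option.some.inj hstep
        have hratio : ((s + 1 : ℕ) : ℝ) / ((n + 1 : ℕ) : ℝ) ≤ (hn : ℝ) / hd := by
          rw [div_le_div_iff₀ (by positivity) (by exact_mod_cast ihd)]
          exact_mod_cast hup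
        exact
          { hB := by rw [hBfilt]; exact iB
            hlen := by rw [hminS, ← hmin]; exact ilen
            hL := by rw [hminS, ← hmin]; exact iL
            hR := hRsum
            hhd := ihd
            hH := fun r hr hle ↦ by
              rcases Nat.lt_or_ge r (n + 1) with hlt | hge
              · exact iH r hr (by omega)
              · have : r = n + 1 := by omega
                subst this
                exact hρle.trans_le hratio }
      case true =>
        rw [hup, cond_true] at hstep
        rw [blt_true_iff] at hup
        obtain rfl := Option.some.inj hstep
        have hratio : (hn : ℝ) / hd < ((s + 1 : ℕ) : ℝ) / ((n + 1 : ℕ) : ℝ) := by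
          rw [div_lt_div_iff₀ (by exact_mod_cast ihd) (by positivity)]
          exact_mod_cast hup
        exact
          { hB := by rw [hBfilt]; exact iB
            hlen := by rw [hminS, ← hmin]; exact ilen
            hL := by rw [hminS, ← hmin]; exact iL
            hR := hRsum
            hhd := Nat.succ_pos n
            hH := fun r hr hle ↦ by
              rcases Nat.lt_or_ge r (n + 1) with hlt | hge
              · exact (iH r hr (by omega)).trans hratio
              · have : r = n + 1 := by omega
                subst this
                exact hρle }
  case true =>
    ----------------------------------------------------------------- smooth
    rw [hm1, cond_true] at hstep
    rw [beq_true_iff] at hm1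
    have hsm : (n + 1).primeFactors ⊆ keySet es := hsm_iff.1 hm1
    have hnT : n + 1 ∉ T := not_mem_freePrimes_of_smooth hv hSall hK hK' hsm
    cases hdv : Nat.beq (M % (D * (n + 1))) 0
    case false => rw [hdv] at hstep; exact absurd hstep (by simp)
    rw [hdv, cond_true] at hstep
    rw [beq_true_iff] at hdv
    -- the new term
    set tN := M / (D * (n + 1)) with htN
    have hMeq : (M : ℂ) = (tN : ℂ) * (D : ℂ) * ((n + 1 : ℕ) : ℂ) := by
      have : M = tN * D * (n + 1) := by
        rw [htN, mul_assoc, Nat.div_mul_cancel (Nat.dvd_of_mod_eq_zero hdv)]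
      exact_mod_cast this
    have hdenC : complMul ω (n + 1) * (D : ℂ) = phasePow es (n + 1) := by
      rw [hden]; exact complMul_mul_denPow es hv (n + 1) (by omega) hsm
    have hn1 : ((n + 1 : ℕ) : ℂ) ≠ 0 := by exact_mod_cast Nat.succ_ne_zero n
    have hterm : ((gr * (tN : ℤ) : ℤ) : ℂ) + ((gi * (tN : ℤ) : ℤ) : ℂ) * I =
        (M : ℂ) * (complMul ω (n + 1) * ((n + 1 : ℕ) : ℂ)⁻¹) := by
      calc ((gr * (tN : ℤ) : ℤ) : ℂ) + ((gi * (tN : ℤ) : ℤ) : ℂ) * I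
          = (tN : ℂ) * ((gr : ℂ) + (gi : ℂ) * I) := by push_cast; ring
        _ = (tN : ℂ) * (complMul ω (n + 1) * (D : ℂ)) := by rw [hphase, hdenC]
        _ = (M : ℂ) * (complMul ω (n + 1) * ((n + 1 : ℕ) : ℂ)⁻¹) := by
            rw [hMeq]; field_simp
    have hBnew : ((Bre + gr * (tN : ℤ) : ℤ) : ℂ) + ((Bim + gi * (tN : ℤ) : ℤ) : ℂ) * I =
        (M : ℂ) * ∑ j ∈ (Finset.Icc 1 (n + 1)).filter (fun j ↦ j.primeFactors ⊆ keySet es),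
          complMul ω j * (j : ℂ)⁻¹ := by
      have hnotin : n + 1 ∉ (Finset.Icc 1 n).filter (fun j ↦ j.primeFactors ⊆ keySet es) := by
        simp
      rw [filter_Icc_succ, if_pos hsm, Finset.sum_insert hnotin, mul_add, ← hterm, ← iB]
      push_cast
      ring
    -- snapshots
    cases hle : Nat.ble (n + 1) K
    case false =>
      -- `K < n + 1`: no snapshot
      rw [hle, cond_false] at hstep
      rw [ble_false_iff, not_le] at hle
      have hminS : min (n + 1) K = K := min_eq_right hle.le
      have hmin : min n K = K := min_eq_right (by omega)
      obtain rfl := Option.some.inj hstep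
      exact
        { hB := hBnew
          hlen := by rw [hminS, ← hmin]; exact ilen
          hL := by rw [hminS, ← hmin]; exact iL
          hR := by rw [hTfilt hnT]; exact iR
          hhd := ihd
          hH := fun r hr hle' ↦ iH r hr (hHmono hnT r hr hle') }
    case true =>
      -- `n + 1 ≤ K`: record the snapshot
      rw [hle, cond_true] at hstep
      rw [ble_true_iff] at hle
      have hminS : min (n + 1) K = n + 1 := min_eq_left hle
      have hmin : min n K = n := min_eq_left (by omega)
      obtain rfl := Option.some.inj hstep
      exact
        { hB := hBnew
          hlen := by simp [ilen, hmin, hminS]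
          hL := fun i hi ↦ by
            rw [hminS] at hi ⊢
            cases i with
            | zero =>
              simp only [List.getD_cons_zero, Nat.sub_zero]
              rw [hBnew, prefSum, filter_smooth_eq_of_le_K hv hSall hK hK' hle]
            | succ i =>
              simp only [List.getD_cons_succ, Nat.add_sub_add_right]
              have := iL i (by rw [hmin]; omega)
              rwa [hmin] at this
          hR := by rw [hTfilt hnT]; exact iR
          hhd := ihd
          hH := fun r hr hle' ↦ iH r hr (hHmono hnT r hr hle') }

/-- **The main loop preserves the invariant**: from `Inv n`, running `fuel` more steps (numbers
`n+1, …, n+fuel ≤ N`) without failure yields `Inv (n + fuel)`. [folklore] -/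
theorem mainGo_inv : ∀ (fuel n : ℕ) {Bre Bim : ℤ} {Lrev : List (ℤ × ℤ)} {Rsum hn hd : ℕ},
    n + fuel ≤ N → Inv N W K M es n Bre Bim Lrev Rsum hn hd →
    ∀ {st : ℤ × ℤ × List (ℤ × ℤ) × ℕ × ℕ × ℕ},
      mainGo N W K M es fuel (n + 1) Bre Bim Lrev Rsum hn hd = some st →
      Inv N W K M es (n + fuel) st.1 st.2.1 st.2.2.1 st.2.2.2.1 st.2.2.2.2.1 st.2.2.2.2.2 := by
  intro fuel
  induction fuel with
  | zero =>
    intro n Bre Bim Lrev Rsum hn hd _ hinv st h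
    rw [mainGo] at h
    obtain rfl := Option.some.inj h
    simpa using hinv
  | succ fuel ih =>
    intro n Bre Bim Lrev Rsum hn hd hle hinv st h
    rw [mainGo] at h
    cases hms : mainStep N W K M es (n + 1) Bre Bim Lrev Rsum hn hd with
    | none => rw [hms] at h; exact absurd h (by simp)
    | some st₁ =>
      rw [hms] at h
      simp only [nat_add_eq] at h
      have h1 := mainStep_inv hv hSall hK hK' (by omega) hinv hms
      have h2 := ih (n + 1) (by omega) h1 h
      rw [show n + (fuel + 1) = n + 1 + fuel by omega]
      exact h2

end Step

end Literature.Barriers.RiemannHypothesis.TuranCheck
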